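import Summits.CriticalPhenomena.PercolationContinuityZ3.Theorems.PercNearOneGluingNoHeavyLowerTailSahiCTCRtThreeBigHarrisForm
import HarnessLib

/-!
# `NoHeavyLowerTail` (crux stmt-CriticalPhenomena-4575), P3 lane: the DEAL form of `R_3` —
# `R_3 = Θ₂·H(F₃, G) − Θ₂·X_{<3}·Z₃ + e_{≥3}·X_{<3}·Z_{<3}` (linear expansion in the small members of `𝒳`)

Support file (seat `prim-l12-p3`, gen 47; `--supports stmt-CriticalPhenomena-4575`).  Memo
`run/shared/lean/prim/prim-l12/FROM-prim-l12-p3-g47-TRANSPORT-CERTIFICATES.md` §3.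

`R_3(𝒳,𝒵)` is LINEAR in the indicator of `𝒳`.  Peeling the small members `X_{<3} = GF(F_{<3})` (for a loop-free up-set: the edges of
`𝒳`) off `X = X₃ + X_{<3}` in `R_3 = Θ₂·(Π·Y_{≥3} − X·Z) + Π·X_{<3}·Z_{<3}` gives, with `Π = Θ₂ + e_{≥3}` and `Y_{≥3} = GF(F₃ ∩ 𝒵)`,
* `Rt_three_eq_dealPoly` : **`R_3 = Θ₂·(Π·GF(F₃ ∩ 𝒵) − GF(F₃)·GF(𝒵)) − Θ₂·GF(F_{<3})·GF(Z₃) + e_{≥3}·GF(F_{<3})·GF(Z_{<3})`**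
  — the Harris form of the pair `(F₃, 𝒵)` (whose coefficients are Kleitman surpluses of `F₃ = atLeast 3 𝒳` against the WHOLE of `𝒵`),
  minus one term per small member of `𝒳`;
* **`coeff_ind_Rt_three_eq_dealForm`** : at a squarefree monomial,
  `[s^V] R_3 = Σ_{U ⊆ V, #U ≤ 2} κ(F₃, 𝒵)(∅, V∖U) − Σ_{U ⊆ V, #U ≤ 2} #pairs(F_{<3}, Z₃)(V∖U) + Σ_{S ⊆ V, 3 ≤ #S} #pairs(F_{<3}, Z_{<3})(V∖S)`,
  i.e. (memo §3, identity (★)) `[s^V] R_3 = KL(F₃,𝒵) − Σ_{c ∈ E_𝒳} (t_𝒵(c) − e_𝒵(c))` with `t_𝒵(c) = #{U ⊆ V∖c, #U ≤ 2 : V∖U∖c ∈ Z₃}` and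
  `e_𝒵(c) = #{S ⊆ V∖c, #S ≥ 3 : V∖S∖c ∈ Z_{<3}}`: for fixed `𝒵` the debt of the pair is a sum over the small members of `𝒳` of `𝒵`-quantities —
  the starting point of the `𝒵`-side ("deal") certificates of the memo (§4), which bound `κ(F₃,𝒵)` below by Kleitman matchings of `𝒵` alone;
* `coeff_ind_Rt_three_nonneg_of_dealForm_le` : the corresponding sufficient condition.
Nothing is asserted about the crux.
-/

noncomputable section

open scoped Classical

namespace Summit.CriticalPhenomena.PercolationContinuityZ3.Theorems.SahiCTCForms

open Finset MvPolynomial SahiCTCGenFun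

variable {α : Type*} [DecidableEq α] [Fintype α]

omit [Fintype α] in
/-- `atLeast 3 (F ∩ G) = atLeast 3 F ∩ G`. [this work] -/
theorem atLeast_inter_left (t : ℕ) (F G : Finset (Finset α)) : atLeast t (F ∩ G) = atLeast t F ∩ G := by
  ext S; simp only [atLeast, mem_filter, mem_inter]; tauto

/-- **THE DEAL FORM OF `R_3` (polynomial identity, all pairs of families)**:
`R_3(𝒳,𝒵) = Θ₂·(Π·GF(X₃ ∩ 𝒵) − GF(X₃)·GF(𝒵)) − Θ₂·GF(X_{<3})·GF(Z₃) + e_{≥3}·GF(X_{<3})·GF(Z_{<3})`. [this work] -/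
theorem Rt_three_eq_dealPoly (F G : Finset (Finset α)) :
    Rt 3 F G = gf (bySize (· < 3)) * (PiP * gf (atLeast 3 F ∩ G) - gf (atLeast 3 F) * gf G)
      - gf (bySize (· < 3)) * (gf (below 3 F) * gf (atLeast 3 G))
      + gf (bySize (3 ≤ ·)) * (gf (below 3 F) * gf (below 3 G)) := by
  unfold Rt
  rw [atLeast_inter_left 3 F G]
  have hX : gf F = gf (atLeast 3 F) + gf (below 3 F) := gf_eq_atLeast_add_below 3 F
  have hZ : gf G = gf (atLeast 3 G) + gf (below 3 G) := gf_eq_atLeast_add_below 3 G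
  rw [PiP_eq_bySize_lt_add_ge (α := α) 3, hX, hZ]
  ring

/-- **THE SQUAREFREE ROW OF `R_3` IN DEAL FORM**: for every finset `V`,
`[s^V] R_3(𝒳,𝒵) = Σ_{U ⊆ V, #U ≤ 2} κ(X₃, 𝒵)(∅, V∖U) − Σ_{U ⊆ V, #U ≤ 2} #pairs(X_{<3}, Z₃)(V∖U) + Σ_{S ⊆ V, 3 ≤ #S} #pairs(X_{<3}, Z_{<3})(V∖S)`
(memo g47 §3 (★): the middle/last sums are `Σ_{c} t_𝒵(c)` and `Σ_c e_𝒵(c)` over the small members `c` of `𝒳`). [this work] -/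
theorem coeff_ind_Rt_three_eq_dealForm (F G : Finset (Finset α)) (V : Finset α) :
    (Rt 3 F G).coeff (ind V) =
      (∑ U ∈ V.powerset.filter (fun U => #U ≤ 2), kap (atLeast 3 F) G ∅ (V \ U))
      - (∑ U ∈ V.powerset.filter (fun U => #U ≤ 2), (pairsAt (below 3 F) (atLeast 3 G) (V \ U) : ℤ))
      + ∑ S ∈ V.powerset.filter (fun S => 3 ≤ #S), (pairsAt (below 3 F) (below 3 G) (V \ S) : ℤ) := by
  rw [Rt_three_eq_dealPoly, coeff_add, coeff_sub, coeff_ind_Theta_harris_eq_sum_kap, coeff_ind_bySize_mul_gf_mul_gf,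
    coeff_ind_bySize_mul_gf_mul_gf, filter_card_lt_three_eq]

/-- **Sufficient condition (deal form)**: if the Kleitman surpluses of `(X₃, 𝒵)` on the top cubes of `2^V` plus the small–small pairs with at least
three idle points dominate the (small member of `𝒳`, big member of `𝒵`) complementary pairs of the top cubes, then `[s^V] R_3(𝒳,𝒵) ≥ 0`. [this work] -/
theorem coeff_ind_Rt_three_nonneg_of_dealForm_le (F G : Finset (Finset α)) (V : Finset α)
    (h : (∑ U ∈ V.powerset.filter (fun U => #U ≤ 2), (pairsAt (below 3 F) (atLeast 3 G) (V \ U) : ℤ))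
        ≤ (∑ U ∈ V.powerset.filter (fun U => #U ≤ 2), kap (atLeast 3 F) G ∅ (V \ U))
          + ∑ S ∈ V.powerset.filter (fun S => 3 ≤ #S), (pairsAt (below 3 F) (below 3 G) (V \ S) : ℤ)) :
    0 ≤ (Rt 3 F G).coeff (ind V) := by
  rw [coeff_ind_Rt_three_eq_dealForm]
  linarith

end Summit.CriticalPhenomena.PercolationContinuityZ3.Theorems.SahiCTCForms
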